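import Summits.Ventures.PercRepro.S1CFGFourThree

/-!
# PercRepro — `D₄` IN EVERY CASE ON `n ≥ 11` POINTS: THE ASSEMBLY (p1, gen 38; stage 4 of the cap `D₄` for every `n`)

The five cases `D₂ = 0` / `= 1` / `2 ≤ D₂ ≤ 3` / `= 4` / `≥ 5` of S1CFGFourTwo / S1CFGFourThree / S1CFGFour assembled:
* **`ncard_dep_four_le`** — `D₄ ≤ 6 · C(n − 4, 2) + 4 · (n − 4) + 1` for every `n ≥ 12` (the value of the extremal
  `N` = a class of `4` ⊕ `U(n − 5, n − 4)`, the case `D₂ ≥ 5`; `201` at `n = 12`; the four other case bounds are below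
  it from `n = 12` on — `5n² − 69n + 108 ≥ 0` for the case `D₂ = 1`), with the rank form **`ncard_four_eRk_le_three_le`**;
* **`ncard_dep_four_le_of_eq_eleven`** — `D₄ ≤ 178` on `11` points (there the case `D₂ = 1` bound
  `C(9, 2) + 14 · 8 + 30` exceeds the extremal `155`), with the rank form **`ncard_four_eRk_le_three_le_of_eq_eleven`**.
Nothing about any cell is claimed. Axioms: standard.
-/

open scoped Matroid

namespace PercRepro

namespace S1CFG

open Set S1CF

variable {α : Type}

/-- **`D₄ ≤ 6 · C(n − 4, 2) + 4 · (n − 4) + 1`** for every `n ≥ 12` — the cap of the ν = 4 program in every case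
(`201` at `n = 12`). -/
theorem ncard_dep_four_le (M : Matroid α) [M.Finite] (hL : ∀ e ∈ M.E, ¬ M.IsLoop e)
    (hK : ∀ e, ¬ M.IsColoop e) (hd : M.E.encard = M.eRank + ((4 : ℕ) : ℕ∞)) (hn : 12 ≤ M.E.ncard) :
    {X : Set α | X ⊆ M.E ∧ X.ncard = 4 ∧ M.Dep X}.ncard ≤
      6 * (M.E.ncard - 4).choose 2 + 4 * (M.E.ncard - 4) + 1 := by
  -- the binomial coefficients as quadratics
  have hq4 : (M.E.ncard - 4).choose 2 = (M.E.ncard - 4) * (M.E.ncard - 5) / 2 := by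
    rw [Nat.choose_two_right]; rfl
  have hq2 : (M.E.ncard - 2).choose 2 = (M.E.ncard - 2) * (M.E.ncard - 3) / 2 := by
    rw [Nat.choose_two_right]; rfl
  have hkey : ∀ m : ℕ, 12 ≤ m → (m - 2) * (m - 3) / 2 + 14 * (m - 3) + 30 ≤
      6 * ((m - 4) * (m - 5) / 2) + 4 * (m - 4) + 1 ∧
      3 * ((m - 2) * (m - 3) / 2) + 5 * (m - 3) + 12 ≤ 6 * ((m - 4) * (m - 5) / 2) + 4 * (m - 4) + 1 ∧
      4 * ((m - 2) * (m - 3) / 2) ≤ 6 * ((m - 4) * (m - 5) / 2) + 4 * (m - 4) + 1 ∧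
      16 * (m - 3) + 35 ≤ 6 * ((m - 4) * (m - 5) / 2) + 4 * (m - 4) + 1 := by
    intro m hm
    obtain ⟨t, rfl⟩ : ∃ t, m = t + 12 := ⟨m - 12, by omega⟩
    have e1 : (t + 12 - 2) * (t + 12 - 3) = t * t + 19 * t + 90 := by
      rw [show t + 12 - 2 = t + 10 by omega, show t + 12 - 3 = t + 9 by omega]; ring
    have e2 : (t + 12 - 4) * (t + 12 - 5) = t * t + 15 * t + 56 := by
      rw [show t + 12 - 4 = t + 8 by omega, show t + 12 - 5 = t + 7 by omega]; ring
    rw [e1, e2, show t + 12 - 3 = t + 9 by omega, show t + 12 - 4 = t + 8 by omega]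
    -- `(t + 7)(t + 8)` is even: its half is exact
    have h56 : (t * t + 15 * t + 56) / 2 * 2 = t * t + 15 * t + 56 := by
      have : 2 ∣ t * t + 15 * t + 56 := by
        have : t * t + 15 * t + 56 = (t + 7) * (t + 8) := by ring
        rw [this]; exact (Nat.even_mul_succ_self (t + 7)).two_dvd
      exact Nat.div_mul_cancel this
    have h90 : (t * t + 19 * t + 90) / 2 * 2 ≤ t * t + 19 * t + 90 := Nat.div_mul_le_self _ 2
    refine ⟨?_, ?_, ?_, ?_⟩ <;> nlinarith [h56, h90, Nat.zero_le t, Nat.zero_le (t * t)]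
  obtain ⟨k1, k2, k3, k4⟩ := hkey M.E.ncard hn
  rw [← hq2] at k1 k2 k3
  rw [← hq4] at k1 k2 k3 k4
  rcases Nat.lt_or_ge {P : Set α | P ⊆ M.E ∧ P.ncard = 2 ∧ M.Dep P}.ncard 4 with hlt | hge
  · rcases Nat.lt_or_ge {P : Set α | P ⊆ M.E ∧ P.ncard = 2 ∧ M.Dep P}.ncard 2 with hlt2 | hge2
    · rcases Nat.lt_or_ge {P : Set α | P ⊆ M.E ∧ P.ncard = 2 ∧ M.Dep P}.ncard 1 with hlt1 | hge1
      · have := ncard_dep_four_le_of_eq_zero M hL hK hd (by omega) (by omega)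
        omega
      · have := ncard_dep_four_le_of_eq_one M hL hK hd (by omega) (by omega)
        omega
    · have := ncard_dep_four_le_of_two_le_of_le_three M hL hK hd (by omega) hge2 (by omega)
      omega
  · rcases Nat.lt_or_ge {P : Set α | P ⊆ M.E ∧ P.ncard = 2 ∧ M.Dep P}.ncard 5 with hlt5 | hge5
    · have := ncard_dep_four_le_of_eq_four M hL hK hd (by omega) (by omega)
      omega
    · exact ncard_dep_four_le_of_five_le M hL hK hd (by omega) hge5

/-- **`D₄ ≤ 178` on `11` points** (the case `D₂ = 1` bound `C(9, 2) + 14 · 8 + 30`). -/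
theorem ncard_dep_four_le_of_eq_eleven (M : Matroid α) [M.Finite] (hL : ∀ e ∈ M.E, ¬ M.IsLoop e)
    (hK : ∀ e, ¬ M.IsColoop e) (hd : M.E.encard = M.eRank + ((4 : ℕ) : ℕ∞)) (hn : M.E.ncard = 11) :
    {X : Set α | X ⊆ M.E ∧ X.ncard = 4 ∧ M.Dep X}.ncard ≤ 178 := by
  have hc9 : (11 - 2 : ℕ).choose 2 = 36 := by decide
  have hc7 : (11 - 4 : ℕ).choose 2 = 21 := by decide
  rcases Nat.lt_or_ge {P : Set α | P ⊆ M.E ∧ P.ncard = 2 ∧ M.Dep P}.ncard 4 with hlt | hge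
  · rcases Nat.lt_or_ge {P : Set α | P ⊆ M.E ∧ P.ncard = 2 ∧ M.Dep P}.ncard 2 with hlt2 | hge2
    · rcases Nat.lt_or_ge {P : Set α | P ⊆ M.E ∧ P.ncard = 2 ∧ M.Dep P}.ncard 1 with hlt1 | hge1
      · have := ncard_dep_four_le_of_eq_zero M hL hK hd (by omega) (by omega)
        rw [hn] at this
        omega
      · have := ncard_dep_four_le_of_eq_one M hL hK hd (by omega) (by omega)
        rw [hn, hc9] at this
        omega
    · have := ncard_dep_four_le_of_two_le_of_le_three M hL hK hd (by omega) hge2 (by omega)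
      rw [hn, hc9] at this
      omega
  · rcases Nat.lt_or_ge {P : Set α | P ⊆ M.E ∧ P.ncard = 2 ∧ M.Dep P}.ncard 5 with hlt5 | hge5
    · have := ncard_dep_four_le_of_eq_four M hL hK hd (by omega) (by omega)
      rw [hn, hc9] at this
      omega
    · have := ncard_dep_four_le_of_five_le M hL hK hd (by omega) hge5
      rw [hn, hc7] at this
      omega

/-- **`D₄`, rank form** (`n ≥ 12`): the `4`-sets of rank `≤ 3` number at most `6 · C(n − 4, 2) + 4 · (n − 4) + 1`. -/
theorem ncard_four_eRk_le_three_le (M : Matroid α) [M.Finite] (hL : ∀ e ∈ M.E, ¬ M.IsLoop e)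
    (hK : ∀ e, ¬ M.IsColoop e) (hd : M.E.encard = M.eRank + ((4 : ℕ) : ℕ∞)) (hn : 12 ≤ M.E.ncard) :
    {X : Set α | X ⊆ M.E ∧ X.ncard = 4 ∧ M.eRk X ≤ 3}.ncard ≤
      6 * (M.E.ncard - 4).choose 2 + 4 * (M.E.ncard - 4) + 1 :=
  (Set.ncard_le_ncard (four_eRk_le_three_subset_dep M)
    (M.ground_finite.finite_subsets.subset (fun _ hX => hX.1))).trans
    (ncard_dep_four_le M hL hK hd hn)

/-- **`D₄ ≤ 178`, rank form, on `11` points**. -/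
theorem ncard_four_eRk_le_three_le_of_eq_eleven (M : Matroid α) [M.Finite] (hL : ∀ e ∈ M.E, ¬ M.IsLoop e)
    (hK : ∀ e, ¬ M.IsColoop e) (hd : M.E.encard = M.eRank + ((4 : ℕ) : ℕ∞)) (hn : M.E.ncard = 11) :
    {X : Set α | X ⊆ M.E ∧ X.ncard = 4 ∧ M.eRk X ≤ 3}.ncard ≤ 178 :=
  (Set.ncard_le_ncard (four_eRk_le_three_subset_dep M)
    (M.ground_finite.finite_subsets.subset (fun _ hX => hX.1))).trans
    (ncard_dep_four_le_of_eq_eleven M hL hK hd hn)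

end S1CFG

end PercRepro
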